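import Summits.BirchSwinnertonDyer.BirchSwinnertonDyer.Theorems.KimAtThreeFineKatoPerFactorSingle
import Summits.BirchSwinnertonDyer.BirchSwinnertonDyer.Theorems.KimAtThreeDeepUpperExpStarFacts
import Summits.BirchSwinnertonDyer.BirchSwinnertonDyer.Theorems.KimAtThreeShallowEqDeepTraceDualLattice
import Summits.BirchSwinnertonDyer.BirchSwinnertonDyer.Theorems.KimAtThreeShallowEqDeepWildDifferentLocal
import Summits.BirchSwinnertonDyer.BirchSwinnertonDyer.Theorems.KimAtThreeSemiLocalTraceDualCyc
import Summits.BirchSwinnertonDyer.Rank1Residual.GaloisImage.CyclotomicTameLevelArithmetic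
import Literature.NumberTheory.AdelicBaseChange.PadicTensorCompletionProofs
import HarnessLib

/-!
# Route `KimAtThreeKolyvagin` (W2): the WEIGHTED defined-Kato package (C1ₑₓʷ) of the shallow off-stratum rows FROM
# the Kato-v2 statement hKatoV2ᵘ (+ R-κ) and the cite facts (S5a), (S5b-tower) — the weighted twin of w2-c2 gen 9's
# `KimAtThreeDeepLowerKatoParts` (items 20396 · 19599 · 19077; cell `bsd-addord`, seat w2-c4 gen 11; `--supports` 19077)

HONEST FRAMING.  TOOL theorem (no definition, no instance attribute, no `sorry`); hKatoV2ʷ is DISPLAYED (= w2-c2's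
hKatoV2ᵘ text VERBATIM with kim3's R-κ clause `∃ u : ℚ, u = κK ∧ v₃(u) = 0` re-inserted, as support item 20396
displays it); (S5a) / (S5b-tower) are cite-only named facts carried as hypotheses; nothing is closed or booked; BSD
is not proved by any of this.  `definedKatoWeighted_of_katoV2_of_facts : (S5a) → (S5b-tower) → hKatoV2ʷ → ∀ row,
(C1ₑₓʷ)` (this seat's DEFKATOW, weights `θ_r := 1` tame / `m′(1 − ζ_m^{m′})` wild).  Proof = w2-c2's
`definedKatoUniformThree_of_katoParts` with (i) the displayed lattice hLatᵘ replaced by the PROVED trace-dual bound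
`Tr(3·exp*_{dw}(z)·o) ∈ 𝒪_v` (`KimAtThreeShallowEqDeepTraceDualLattice`), transported along `S_w` by
`trace_galAdicCompletionMap`; (ii) w2-acc3's `3^{v₃(m)}`-step replaced by the EXACT ones (tame:
`symm_mem_cycIntLattice_of_forall_trace_mul_mem`; wild: `wild_mul_symm_mem_cycIntLattice_of_forall_trace_mul_mem`).
With the parity rider and gen 10's consumers (`KimAtThreeShallowEqDeepOffStratumOfDefinedKatoWeighted`): the
non-additive NON-ANOMALOUS `t = 0` rows of 19599 / 19077 ⟸ «leaves ∧ (S5a) ∧ (S5b-tower) ∧ hKatoV2ʷ».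
References: [Kato2004Asterisque] (8.1.3), §9.4, Thm. 9.7, Ex. 13.3; [Kato1993LNM1553] II Thm. 1.4.1; [BlochKato1990] §3
Prop. 3.8; [CasselsFrohlichANT1967] II §10, VII §1.1; [SerreLocalFields1979] III §6; memo HOME/w2c4/W2C4-WEIGHTED-COMPAT-g11.md.
-/

set_option autoImplicit false

noncomputable section

-- the cell's Theorems namespace `Summit.BirchSwinnertonDyer.BirchSwinnertonDyer.…` repeats the summit name by design (D-0017)
set_option linter.dupNamespace false

open scoped Classical NumberField TensorProduct ContRepresentation Pointwise
open Field ValuativeRel Function IsDedekindDomain NumberField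
open WeierstrassCurve Literature.NumberTheory.EllipticCurves Literature.NumberTheory.GaloisRepresentations
  Literature.NumberTheory.GaloisRepresentations.DiscreteGaloisModule Literature.NumberTheory.GaloisCohomology
open Literature.NumberTheory.GaloisRepresentations.PeriodRingData Literature.NumberTheory.PAdicHodge Literature.NumberTheory.EllipticCurves.ModularForms Literature.NumberTheory.EllipticCurves.Rank1Residual
open Literature.NumberTheory.EllipticCurves.Kato2004 Literature.NumberTheory.EllipticCurves.Kato2004.EulerSystemValues
open Literature.NumberTheory.AdelicBaseChange Literature.NumberTheory.Automorphic
open Summit.BirchSwinnertonDyer.Rank1Residual.GaloisImage Summit.BirchSwinnertonDyer.Rank1Residual.Additive.LocalLog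
open Summit.BirchSwinnertonDyer.BirchSwinnertonDyer.Theorems
open Summit.BirchSwinnertonDyer.BirchSwinnertonDyer.Theorems.KimAtThreeFineKatoLevelCompat
open Summit.BirchSwinnertonDyer.BirchSwinnertonDyer.Theorems.KimAtThreeFineKatoPerFactorDefined
open Summit.BirchSwinnertonDyer.BirchSwinnertonDyer.Theorems.KimAtThreeFineKatoPerFactorDefinedTwist
open Summit.BirchSwinnertonDyer.BirchSwinnertonDyer.Theorems.KimAtThreeDeepLowerExpStarOmega
open Summit.BirchSwinnertonDyer.BirchSwinnertonDyer.Theorems.KimAtThreeDeepLowerExpStarOmegaPlace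
open Summit.BirchSwinnertonDyer.BirchSwinnertonDyer.Theorems.KimAtThreeFineKatoPerFactorPlaces
open Summit.BirchSwinnertonDyer.BirchSwinnertonDyer.Theorems.KimAtThreeDeepUpperExpStarFacts
open Summit.BirchSwinnertonDyer.Rank1Residual.GaloisImage.TameLevel (squarefree_cycLevel_zero)

open Summit.BirchSwinnertonDyer.BirchSwinnertonDyer.Theorems.KimAtThreeSemiLocalTraceDualCyc
open Summit.BirchSwinnertonDyer.BirchSwinnertonDyer.Theorems.KimAtThreeShallowEqDeepTraceDualLattice
open Summit.BirchSwinnertonDyer.BirchSwinnertonDyer.Theorems.KimAtThreeShallowEqDeepWildDifferentLocal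
open Summit.BirchSwinnertonDyer.BirchSwinnertonDyer.Theorems.KimAtThreeShallowEqDeepRiderOfWeightedCompat

namespace Summit.BirchSwinnertonDyer.BirchSwinnertonDyer.Theorems.KimAtThreeShallowEqDeepWeightedOfKatoV2

/-- Local notation: the WEIGHTED compatibility COMPATW_b (this seat's `…RiderOfWeightedCompat`, VERBATIM). -/
local notation3 (prettyPrint := false) "COMPATW⟦" W' ", " j ", " v' ", " Λ' ", " φ0 ", " b ", " θ' "⟧" =>
  ∀ (r : Finset (HeightOneSpectrum (𝓞 ℚ)))
    (Ψ : H1 (tateRep W' 3) (cycSubgroup 3 0 r) →+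
      continuousCohomology 1 (subgroupRep
        (WeierstrassCurve.torsionGaloisModule W' (((3 : ℕ) : ℤ) ^ j * ((3 : ℕ) : ℤ))).toTopRep (cycSubgroup 3 0 r))),
    (∀ (φ₁ : contOneCocycles (subgroupRep (tateRep W' 3).toTopRep (cycSubgroup 3 0 r)))
        (ψ : contOneCocycles (subgroupRep
          (WeierstrassCurve.torsionGaloisModule W' (((3 : ℕ) : ℤ) ^ j * ((3 : ℕ) : ℤ))).toTopRep (cycSubgroup 3 0 r))),
        (∀ g, ((ψ.1 g : geomTorsion W' (((3 : ℕ) : ℤ) ^ j * ((3 : ℕ) : ℤ))) : geomPoints W') =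
          TateModule.proj 3 (j + 1) (φ₁.1 g)) →
        Ψ (oneCocycleClass _ φ₁) = oneCocycleClass _ ψ) →
    ∀ (y : H1 (tateRep W' 3) (cycSubgroup 3 0 r))
      (κ₀ : galoisCohomology (WeierstrassCurve.torsionGaloisModule W' (((3 : ℕ) : ℤ) ^ j * ((3 : ℕ) : ℤ))) 1)
      (h : (tateLocalRep W' 3 (Sum.inr v')).cohomology 1),
      resSubgroup (WeierstrassCurve.torsionGaloisModule W' (((3 : ℕ) : ℤ) ^ j * ((3 : ℕ) : ℤ))).toTopRep
          (cycSubgroup 3 0 r) 1 κ₀ = Ψ y →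
      galoisCohomology.localization (WeierstrassCurve.torsionGaloisModule W' (((3 : ℕ) : ℤ) ^ j * ((3 : ℕ) : ℤ)))
          (Sum.inr v') 1 κ₀ = tateLocalMap W' 3 j (Sum.inr v') h →
      ∃ l ∈ cycIntLattice 3 (cycLevel 3 0 r),
        ((1 : ℚ_[3]) ⊗ₜ[ℚ] (θ' r : CyclotomicField (cycLevel 3 0 r) ℚ)) *
            ((((3 : ℕ) : ℤ_[3]) ^ b) • ((φ0 h ⊗ₜ[ℚ] (1 : CyclotomicField (cycLevel 3 0 r) ℚ)) - Λ' 0 r y)) =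
          (((3 : ℕ) : ℤ_[3]) ^ (j + 1)) • (l : ℚ_[3] ⊗[ℚ] CyclotomicField (cycLevel 3 0 r) ℚ)

/-- Local notation: admissible weights (VERBATIM from `…RiderOfWeightedCompat`). -/
local notation3 (prettyPrint := false) "WEIGHT⟦" θ' "⟧" =>
  ∀ r : Finset (HeightOneSpectrum (𝓞 ℚ)),
    ((1 : ℚ_[3]) ⊗ₜ[ℚ] (θ' r : CyclotomicField (cycLevel 3 0 r) ℚ)) ∈ cycIntLattice 3 (cycLevel 3 0 r) ∧
    ∃ l₀ ∈ cycIntLattice 3 (cycLevel 3 0 r),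
      ((1 : ℚ_[3]) ⊗ₜ[ℚ] (θ' r : CyclotomicField (cycLevel 3 0 r) ℚ)) *
          ((1 : ℚ_[3]) ⊗ₜ[ℚ] (θ' r : CyclotomicField (cycLevel 3 0 r) ℚ)) * l₀ =
        ((3 : ℕ) : ℚ_[3]) ⊗ₜ[ℚ] (1 : CyclotomicField (cycLevel 3 0 r) ℚ)

/-- Local notation: the weighted package (C1ₑₓʷ) at the row (VERBATIM from `…OffStratumOfDefinedKatoWeighted`). -/
local notation3 (prettyPrint := false) "DEFKATOW⟦" W' ", " v' ", " N' ", " P' "⟧" =>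
  ∃ (ι : (n : ℕ) → (CyclotomicField n ℚ →+* ℂ)) (κK : ℝ)
    (Λ : ∀ (k' : ℕ) (r : Finset (HeightOneSpectrum (𝓞 ℚ))),
      H1 (tateRep W' 3) (cycSubgroup 3 k' r) →ₗ[ℤ_[3]] ℚ_[3] ⊗[ℚ] CyclotomicField (cycLevel 3 k' r) ℚ)
    (φ : (tateLocalRep W' 3 (Sum.inr v')).cohomology 1 →+ ℚ_[3])
    (θ : ∀ r : Finset (HeightOneSpectrum (𝓞 ℚ)), CyclotomicField (cycLevel 3 0 r) ℚ),
    κK ≠ 0 ∧ (∃ u : ℚ, (u : ℝ) = κK ∧ padicValRat 3 u = 0) ∧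
    (∀ y, φ y = 0 ↔ ∀ j : ℕ, tateLocalMap W' 3 j (Sum.inr v') y ∈
      WeierstrassCurve.kummerSelmerStructure W' (((3 : ℕ) : ℤ) ^ j * ((3 : ℕ) : ℤ)) (Sum.inr v')) ∧
    (∀ a : ℚ_[3], (∃ y, φ y = a) ↔
      ∀ Q : ((W' : WeierstrassCurve ℚ).baseChange ℚ_[3]).toAffine.Point,
        ‖a * padicLog ((W' : WeierstrassCurve ℚ).baseChange ℚ_[3]) Q‖ ≤ 1) ∧
    WEIGHT⟦θ⟧ ∧
    (∀ j : ℕ, COMPATW⟦W', j, v', Λ, φ, 1, θ⟧) ∧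
    ∀ (c d a : ℤ) (A : ℕ), 0 < A → Int.gcd c (6 * 3 * A) = 1 → Int.gcd d (6 * 3 * N') = 1 →
      ∃ (z : ∀ (k' : ℕ) (r : (cyclotomicLevelsRat 3 (badPlaces c d A N')).Ideals),
            H1 (tateRep W' 3) ((cyclotomicLevelsRat 3 (badPlaces c d A N')).level k' r.1))
        (x : ∀ (k' : ℕ) (r : (cyclotomicLevelsRat 3 (badPlaces c d A N')).Ideals),
            CyclotomicField (cycLevel 3 k' r.1) ℚ),
        ZetaBody W' 3 (P' : ModularParametrizationData W' N').f ι κK Λ c d a A z x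

set_option backward.isDefEq.respectTransparency false in
set_option maxHeartbeats 800000 in
/-- **(C1ₑₓʷ) from (S5a), (S5b-tower) and hKatoV2ʷ** (= hKatoV2ᵘ + R-κ) on EVERY `3`-adic-tower row with a
lattice-optimal parametrisation at the conductor; weights `θ_r = 1` (tame) / `m′(1 − ζ_m^{m′})` (wild).
[cite: Kato2004Asterisque, §9.4 (p. 188), Thm. 9.7 (p. 189) and Ex. 13.3 (pp. 224–225)] [cite: BlochKato1990, §3 Prop. 3.8, Ex. 3.11]
[cite: CasselsFrohlichANT1967, Ch. II §10 Theorem (10.2) and §11, Ch. VII §1.1] [cite: SerreLocalFields1979, Ch. III §6, Prop. 13] -/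
theorem definedKatoWeighted_of_katoV2_of_facts (hS : expStarCoord_eq_zero_iff_kummer)
    (hT₂ : exists_smul_range_expStarCoord_tower_iff_trace_log)
    (hKatoV2 : ∀ (W : WeierstrassCurve ℚ) [W.IsElliptic] [W.IsGloballyMinimal]
      [ContinuousSMul ℤ_[3] (W.tateModule 3)] [Module.Free ℤ_[3] (W.tateModule 3)]
      [Module.Finite ℤ_[3] (W.tateModule 3)],
      (∀ m : ℕ, W.HasSurjectiveModNGaloisRep (3 ^ m : ℕ)) →
      ∀ {N : ℕ} [NeZero N] (P : ModularParametrizationData W N), N = W.conductorNorm ℤ →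
        (∀ z ∈ P.L.lattice, ∃ w ∈ periodLattice P.f, z = P.c * w) →
        haveI : Fact (((3 : ℕ) : 𝓞 ℚ) ∈ ((Rat.HeightOneSpectrum.primesEquiv (R := 𝓞 ℚ)).symm ⟨3, Fact.out⟩).asIdeal) :=
          ⟨(natCast_mem_asIdeal_iff_eq_primesEquiv_symm _ Nat.prime_three).mpr rfl⟩
        letI := valuativeRelPlace ((Rat.HeightOneSpectrum.primesEquiv (R := 𝓞 ℚ)).symm ⟨3, Fact.out⟩)
        letI := topologicalSpacePlace ((Rat.HeightOneSpectrum.primesEquiv (R := 𝓞 ℚ)).symm ⟨3, Fact.out⟩)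
        haveI := isNonarchimedeanLocalField_place ((Rat.HeightOneSpectrum.primesEquiv (R := 𝓞 ℚ)).symm ⟨3, Fact.out⟩)
        haveI := charZero_place ((Rat.HeightOneSpectrum.primesEquiv (R := 𝓞 ℚ)).symm ⟨3, Fact.out⟩)
        letI := padicAlgebraPlace 3 ((Rat.HeightOneSpectrum.primesEquiv (R := 𝓞 ℚ)).symm ⟨3, Fact.out⟩)
        haveI := fact_not_isUnit_place 3 ((Rat.HeightOneSpectrum.primesEquiv (R := 𝓞 ℚ)).symm ⟨3, Fact.out⟩)
        haveI := isAdicComplete_place 3 ((Rat.HeightOneSpectrum.primesEquiv (R := 𝓞 ℚ)).symm ⟨3, Fact.out⟩)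
        ∃ (d : LocalNeronLineAt W 3 ((Rat.HeightOneSpectrum.primesEquiv (R := 𝓞 ℚ)).symm ⟨3, Fact.out⟩))
          (hinj : (bdRPeriodRingData (valuation_place_lt_one 3 ((Rat.HeightOneSpectrum.primesEquiv (R := 𝓞 ℚ)).symm ⟨3, Fact.out⟩))).CupLogInjective (logCyclotomic 3)
            (localRationalTateRep W 3 (galRestrictPlace ((Rat.HeightOneSpectrum.primesEquiv (R := 𝓞 ℚ)).symm ⟨3, Fact.out⟩))))
          (hex : ∀ z : contOneCocycles (localRationalTateRep W 3 (galRestrictPlace ((Rat.HeightOneSpectrum.primesEquiv (R := 𝓞 ℚ)).symm ⟨3, Fact.out⟩))).toTopRep,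
            (bdRPeriodRingData (valuation_place_lt_one 3 ((Rat.HeightOneSpectrum.primesEquiv (R := 𝓞 ℚ)).symm ⟨3, Fact.out⟩))).HasDualExp (logCyclotomic 3)
              (localRationalTateRep W 3 (galRestrictPlace ((Rat.HeightOneSpectrum.primesEquiv (R := 𝓞 ℚ)).symm ⟨3, Fact.out⟩))) fun σ => z.1 σ),
          (∀ a : ℚ_[3], (∃ y, (expStarOmegaPadicAt d hinj hex (((Padic.adicCompletionEquiv (𝓞 ℚ) ⟨3, Fact.out⟩).symm : (((Rat.HeightOneSpectrum.primesEquiv (R := 𝓞 ℚ)).symm ⟨3, Fact.out⟩).adicCompletion ℚ) →+* ℚ_[3]))) y = a) ↔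
            ∀ Q : (W.baseChange ℚ_[3]).toAffine.Point, ‖a * padicLog (W.baseChange ℚ_[3]) Q‖ ≤ 1) ∧
        ∃ (ι : (n : ℕ) → (CyclotomicField n ℚ →+* ℂ)) (κK : ℝ)
          (Λ : ∀ (k' : ℕ) (r : Finset (HeightOneSpectrum (𝓞 ℚ))),
            H1 (tateRep W 3) (cycSubgroup 3 k' r) →ₗ[ℤ_[3]]
              ℚ_[3] ⊗[ℚ] CyclotomicField (cycLevel 3 k' r) ℚ),
          κK ≠ 0 ∧ (∃ u : ℚ, (u : ℝ) = κK ∧ padicValRat 3 u = 0) ∧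
          (∀ (j : ℕ) (r : Finset (HeightOneSpectrum (𝓞 ℚ)))
            (Ψ : ℚ_[3] ⊗[ℚ] CyclotomicField (cycLevel 3 0 r) ℚ ≃ₐ[ℚ]
              (Π w : ((Rat.HeightOneSpectrum.primesEquiv (R := 𝓞 ℚ)).symm ⟨3, Fact.out⟩).Extension
                (𝓞 (CyclotomicField (cycLevel 3 0 r) ℚ)), w.1.adicCompletion (CyclotomicField (cycLevel 3 0 r) ℚ)))
            (hΨ : ∀ (s : ℚ_[3]) (x : CyclotomicField (cycLevel 3 0 r) ℚ)
              (w : ((Rat.HeightOneSpectrum.primesEquiv (R := 𝓞 ℚ)).symm ⟨3, Fact.out⟩).Extension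
                (𝓞 (CyclotomicField (cycLevel 3 0 r) ℚ))),
              Ψ (s ⊗ₜ[ℚ] x) w =
                algebraMap (CyclotomicField (cycLevel 3 0 r) ℚ) (w.1.adicCompletion (CyclotomicField (cycLevel 3 0 r) ℚ)) x *
                algebraMap (((Rat.HeightOneSpectrum.primesEquiv (R := 𝓞 ℚ)).symm ⟨3, Fact.out⟩).adicCompletion ℚ)
                  (w.1.adicCompletion (CyclotomicField (cycLevel 3 0 r) ℚ)) ((Padic.adicCompletionEquiv (𝓞 ℚ) ⟨3, Fact.out⟩) s)),
            ∃ (w₀ : ((Rat.HeightOneSpectrum.primesEquiv (R := 𝓞 ℚ)).symm ⟨3, Fact.out⟩).Extension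
                (𝓞 (CyclotomicField (cycLevel 3 0 r) ℚ)))
              (g : ((Rat.HeightOneSpectrum.primesEquiv (R := 𝓞 ℚ)).symm ⟨3, Fact.out⟩).Extension
                (𝓞 (CyclotomicField (cycLevel 3 0 r) ℚ)) → absoluteGaloisGroup ℚ)
              (hg : ∀ w : ((Rat.HeightOneSpectrum.primesEquiv (R := 𝓞 ℚ)).symm ⟨3, Fact.out⟩).Extension
                (𝓞 (CyclotomicField (cycLevel 3 0 r) ℚ)),
                sigma (cycLevel 3 0 r) (modNCyclotomicCharacter ℚ (cycLevel 3 0 r) (g w)) • w.1 = w₀.1),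
                letI := LocalField.charZero_adicCompletion w₀.1
                letI := LocalField.adicCompletionPadicAlgebra w₀.1 3 (three_mem_asIdeal_extension _ w₀)
                haveI : Fact (¬ IsUnit ((3 : ℕ) : integerC (w₀.1.adicCompletion (CyclotomicField (cycLevel 3 0 r) ℚ)))) :=
                  ⟨not_isUnit_natCast_integerC (LocalField.valuation_adicCompletion_natCast_lt_one w₀.1 3 (three_mem_asIdeal_extension _ w₀))⟩
                haveI := isAdicComplete_integerC_natCast (LocalField.valuation_adicCompletion_natCast_lt_one w₀.1 3 (three_mem_asIdeal_extension _ w₀))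
                ∃ (dw : LocalNeronLine W (LocalField.valuation_adicCompletion_natCast_lt_one w₀.1 3 (three_mem_asIdeal_extension _ w₀))
                  ((galRestrictPlace ((Rat.HeightOneSpectrum.primesEquiv (R := 𝓞 ℚ)).symm ⟨3, Fact.out⟩)).comp
                    (absGaloisRestrict (((Rat.HeightOneSpectrum.primesEquiv (R := 𝓞 ℚ)).symm ⟨3, Fact.out⟩).adicCompletion ℚ) (w₀.1.adicCompletion (CyclotomicField (cycLevel 3 0 r) ℚ)))))
                  (hinjw : (bdRPeriodRingData (LocalField.valuation_adicCompletion_natCast_lt_one w₀.1 3 (three_mem_asIdeal_extension _ w₀))).CupLogInjective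
                  (logCyclotomic 3) (localRationalTateRep W 3 ((galRestrictPlace ((Rat.HeightOneSpectrum.primesEquiv (R := 𝓞 ℚ)).symm ⟨3, Fact.out⟩)).comp
                    (absGaloisRestrict (((Rat.HeightOneSpectrum.primesEquiv (R := 𝓞 ℚ)).symm ⟨3, Fact.out⟩).adicCompletion ℚ) (w₀.1.adicCompletion (CyclotomicField (cycLevel 3 0 r) ℚ))))))
                  (hexw : ∀ z : contOneCocycles (localRationalTateRep W 3 ((galRestrictPlace ((Rat.HeightOneSpectrum.primesEquiv (R := 𝓞 ℚ)).symm ⟨3, Fact.out⟩)).comp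
                    (absGaloisRestrict (((Rat.HeightOneSpectrum.primesEquiv (R := 𝓞 ℚ)).symm ⟨3, Fact.out⟩).adicCompletion ℚ) (w₀.1.adicCompletion (CyclotomicField (cycLevel 3 0 r) ℚ))))).toTopRep,
                  (bdRPeriodRingData (LocalField.valuation_adicCompletion_natCast_lt_one w₀.1 3 (three_mem_asIdeal_extension _ w₀))).HasDualExp
                    (logCyclotomic 3) (localRationalTateRep W 3 ((galRestrictPlace ((Rat.HeightOneSpectrum.primesEquiv (R := 𝓞 ℚ)).symm ⟨3, Fact.out⟩)).comp
                    (absGaloisRestrict (((Rat.HeightOneSpectrum.primesEquiv (R := 𝓞 ℚ)).symm ⟨3, Fact.out⟩).adicCompletion ℚ) (w₀.1.adicCompletion (CyclotomicField (cycLevel 3 0 r) ℚ))))) fun σ => z.1 σ),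
                  (∀ (h : (tateLocalRep W 3 (Sum.inr ((Rat.HeightOneSpectrum.primesEquiv (R := 𝓞 ℚ)).symm ⟨3, Fact.out⟩))).cohomology 1),
                  (expStarOmegaHom (LocalField.valuation_adicCompletion_natCast_lt_one w₀.1 3 (three_mem_asIdeal_extension _ w₀))
                    ((galRestrictPlace ((Rat.HeightOneSpectrum.primesEquiv (R := 𝓞 ℚ)).symm ⟨3, Fact.out⟩)).comp
                    (absGaloisRestrict (((Rat.HeightOneSpectrum.primesEquiv (R := 𝓞 ℚ)).symm ⟨3, Fact.out⟩).adicCompletion ℚ) (w₀.1.adicCompletion (CyclotomicField (cycLevel 3 0 r) ℚ)))) dw hinjw hexw)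
                    (ContinuousRep.cohomologyRes (tateLocalRep W 3 (Sum.inr ((Rat.HeightOneSpectrum.primesEquiv (R := 𝓞 ℚ)).symm ⟨3, Fact.out⟩)))
                      (absGaloisRestrict (((Rat.HeightOneSpectrum.primesEquiv (R := 𝓞 ℚ)).symm ⟨3, Fact.out⟩).adicCompletion ℚ) (w₀.1.adicCompletion (CyclotomicField (cycLevel 3 0 r) ℚ))) 1 h) =
                  algebraMap (((Rat.HeightOneSpectrum.primesEquiv (R := 𝓞 ℚ)).symm ⟨3, Fact.out⟩).adicCompletion ℚ) (w₀.1.adicCompletion (CyclotomicField (cycLevel 3 0 r) ℚ)) (expStarOmegaAt d h)) ∧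
                  (∀ (w : ((Rat.HeightOneSpectrum.primesEquiv (R := 𝓞 ℚ)).symm ⟨3, Fact.out⟩).Extension
                    (𝓞 (CyclotomicField (cycLevel 3 0 r) ℚ)))
                  (y : H1 (tateRep W 3) (cycSubgroup 3 0 r))
                  (φ'' : contOneCocycles (subgroupRep (tateRep W 3).toTopRep (cycSubgroup 3 0 r)))
                  (ψT : contOneCocycles ((tateLocalRep W 3 (Sum.inr ((Rat.HeightOneSpectrum.primesEquiv (R := 𝓞 ℚ)).symm ⟨3, Fact.out⟩))).restrict
                    (absGaloisRestrict (((Rat.HeightOneSpectrum.primesEquiv (R := 𝓞 ℚ)).symm ⟨3, Fact.out⟩).adicCompletion ℚ) (w₀.1.adicCompletion (CyclotomicField (cycLevel 3 0 r) ℚ)))).toTopRep),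
                  oneCocycleClass _ φ'' = conjMap (tateRep W 3).toTopRep (cycSubgroup 3 0 r) (g w) 1 y →
                  (∀ σ, ψT.1 σ = φ''.1 ⟨absGaloisRestrictTower ℚ (((Rat.HeightOneSpectrum.primesEquiv (R := 𝓞 ℚ)).symm ⟨3, Fact.out⟩).adicCompletion ℚ) (w₀.1.adicCompletion (CyclotomicField (cycLevel 3 0 r) ℚ)) σ,
                    absGaloisRestrictTower_adicCompletion_mem_cycSubgroup r w₀ σ⟩) →
                  Ψ (Λ 0 r y) w = galAdicCompletionMap
                    (sigma (cycLevel 3 0 r) (modNCyclotomicCharacter ℚ (cycLevel 3 0 r) (g w)))⁻¹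
                    (inv_smul_eq_of_smul_eq (hg w))
                    ((expStarOmegaHom (LocalField.valuation_adicCompletion_natCast_lt_one w₀.1 3 (three_mem_asIdeal_extension _ w₀))
                    ((galRestrictPlace ((Rat.HeightOneSpectrum.primesEquiv (R := 𝓞 ℚ)).symm ⟨3, Fact.out⟩)).comp
                    (absGaloisRestrict (((Rat.HeightOneSpectrum.primesEquiv (R := 𝓞 ℚ)).symm ⟨3, Fact.out⟩).adicCompletion ℚ) (w₀.1.adicCompletion (CyclotomicField (cycLevel 3 0 r) ℚ)))) dw hinjw hexw) (oneCocycleClass _ ψT)))) ∧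
          ∀ (c d a : ℤ) (A : ℕ), 0 < A → Int.gcd c (6 * 3 * A) = 1 → Int.gcd d (6 * 3 * N) = 1 →
            ∃ (z : ∀ (k' : ℕ) (r : (cyclotomicLevelsRat 3 (badPlaces c d A N)).Ideals),
                  H1 (tateRep W 3) ((cyclotomicLevelsRat 3 (badPlaces c d A N)).level k' r.1))
              (x : ∀ (k' : ℕ) (r : (cyclotomicLevelsRat 3 (badPlaces c d A N)).Ideals),
                  CyclotomicField (cycLevel 3 k' r.1) ℚ),
              ZetaBody W 3 P.f ι κK Λ c d a A z x) :
    ∀ (W : WeierstrassCurve ℚ) [W.IsElliptic] [W.IsGloballyMinimal]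
      [ContinuousSMul ℤ_[3] (W.tateModule 3)] [Module.Free ℤ_[3] (W.tateModule 3)]
      [Module.Finite ℤ_[3] (W.tateModule 3)],
      (∀ m : ℕ, W.HasSurjectiveModNGaloisRep (3 ^ m : ℕ)) →
      ∀ (v₃ : HeightOneSpectrum (𝓞 ℚ)), ((3 : ℕ) : 𝓞 ℚ) ∈ v₃.asIdeal →
      ∀ {N : ℕ} [NeZero N] (P : ModularParametrizationData W N), N = W.conductorNorm ℤ →
        (∀ z ∈ P.L.lattice, ∃ w ∈ periodLattice P.f, z = P.c * w) →
        DEFKATOW⟦W, v₃, N, P⟧ := by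
  intro W _ _ _ _ _ htow v₃ hv₃ N _ P hN hlat
  -- the row's place IS `v₀ = primesEquiv.symm 3`
  have hv₃eq : v₃ = ((Rat.HeightOneSpectrum.primesEquiv (R := 𝓞 ℚ)).symm ⟨3, Fact.out⟩) := by
    have h3 := primesEquiv_eq_of_natCast_mem Nat.prime_three hv₃
    have h3' : Rat.HeightOneSpectrum.primesEquiv (R := 𝓞 ℚ) v₃ = ⟨3, Fact.out⟩ := Subtype.ext h3
    rw [← h3', Equiv.symm_apply_apply]
  subst hv₃eq
  haveI : Fact (((3 : ℕ) : 𝓞 ℚ) ∈ ((Rat.HeightOneSpectrum.primesEquiv (R := 𝓞 ℚ)).symm ⟨3, Fact.out⟩).asIdeal) :=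
    ⟨(natCast_mem_asIdeal_iff_eq_primesEquiv_symm _ Nat.prime_three).mpr rfl⟩
  letI := valuativeRelPlace ((Rat.HeightOneSpectrum.primesEquiv (R := 𝓞 ℚ)).symm ⟨3, Fact.out⟩)
  letI := topologicalSpacePlace ((Rat.HeightOneSpectrum.primesEquiv (R := 𝓞 ℚ)).symm ⟨3, Fact.out⟩)
  haveI := isNonarchimedeanLocalField_place ((Rat.HeightOneSpectrum.primesEquiv (R := 𝓞 ℚ)).symm ⟨3, Fact.out⟩)
  haveI := charZero_place ((Rat.HeightOneSpectrum.primesEquiv (R := 𝓞 ℚ)).symm ⟨3, Fact.out⟩)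
  letI := padicAlgebraPlace 3 ((Rat.HeightOneSpectrum.primesEquiv (R := 𝓞 ℚ)).symm ⟨3, Fact.out⟩)
  haveI := fact_not_isUnit_place 3 ((Rat.HeightOneSpectrum.primesEquiv (R := 𝓞 ℚ)).symm ⟨3, Fact.out⟩)
  haveI := isAdicComplete_place 3 ((Rat.HeightOneSpectrum.primesEquiv (R := 𝓞 ℚ)).symm ⟨3, Fact.out⟩)
  obtain ⟨d, hinj, hex, hdual, ι, κK, Λ, hκ0, hunit, hkat, hz⟩ := hKatoV2 W htow P hN hlat
  -- `φ := exp*_ω` at `ℚ₃` in the `ℚ_[3]` currency (this seat's gen-8 definition)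
  let φ : (tateLocalRep W 3 (Sum.inr ((Rat.HeightOneSpectrum.primesEquiv (R := 𝓞 ℚ)).symm ⟨3, Fact.out⟩))).cohomology 1 →+ ℚ_[3] :=
    expStarOmegaPadicAt d hinj hex
      (((Padic.adicCompletionEquiv (𝓞 ℚ) ⟨3, Fact.out⟩).symm : (((Rat.HeightOneSpectrum.primesEquiv (R := 𝓞 ℚ)).symm ⟨3, Fact.out⟩).adicCompletion ℚ) →+* ℚ_[3]))
  let θ : ∀ r : Finset (HeightOneSpectrum (𝓞 ℚ)), CyclotomicField (cycLevel 3 0 r) ℚ := fun r =>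
    if 3 ∣ cycLevel 3 0 r then
      (((cycLevel 3 0 r / 3 : ℕ) : CyclotomicField (cycLevel 3 0 r) ℚ) *
        (1 - IsCyclotomicExtension.zeta (cycLevel 3 0 r) ℚ (CyclotomicField (cycLevel 3 0 r) ℚ) ^ (cycLevel 3 0 r / 3)))
    else 1
  have hθdef : ∀ r : Finset (HeightOneSpectrum (𝓞 ℚ)), θ r =
      if 3 ∣ cycLevel 3 0 r then
        (((cycLevel 3 0 r / 3 : ℕ) : CyclotomicField (cycLevel 3 0 r) ℚ) *
          (1 - IsCyclotomicExtension.zeta (cycLevel 3 0 r) ℚ (CyclotomicField (cycLevel 3 0 r) ℚ) ^ (cycLevel 3 0 r / 3)))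
      else 1 := fun _ => rfl
  have h9 : ∀ r : Finset (HeightOneSpectrum (𝓞 ℚ)), 3 ∣ cycLevel 3 0 r → ¬ 3 ∣ cycLevel 3 0 r / 3 := by
    intro r h3 h
    have hsq := squarefree_cycLevel_zero 3 r
    obtain ⟨k, hk⟩ := h
    have := hsq 3 ⟨k, by rw [mul_assoc, ← hk, Nat.mul_div_cancel' h3]⟩
    simp at this
  have hθ : WEIGHT⟦θ⟧ := by
    intro r
    by_cases h3 : 3 ∣ cycLevel 3 0 r
    · rw [hθdef, if_pos h3]
      exact weight_natCast_mul_one_sub_zeta_pow (cycLevel 3 0 r) h3 (h9 r h3)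
    · rw [hθdef, if_neg h3]
      exact weight_one 3 (cycLevel 3 0 r)
  refine ⟨ι, κK, Λ, φ, θ, hκ0, hunit, hker_of_facts W 3 _ hS d hinj hex _, hdual, hθ,
    fun j r Ψ' hΨ' y κ₀ h hres hlocκ => ?_, hz⟩
  -- w2-acc4's semi-local algebra `Ψ : ℚ_[3] ⊗ ℚ(ζ_m) ≃ ∏_{w ∣ 3} L_w`
  obtain ⟨Ψ, hΨ⟩ := exists_padicTensorAlgEquiv (CyclotomicField (cycLevel 3 0 r) ℚ) 3
  obtain ⟨w₀, g, hg, dw, hinjw, hexw, hresw, hdefw⟩ := hkat j r Ψ hΨ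
  letI := LocalField.charZero_adicCompletion w₀.1
  letI := LocalField.adicCompletionPadicAlgebra w₀.1 3 (three_mem_asIdeal_extension _ w₀)
  haveI : Fact (¬ IsUnit ((3 : ℕ) : integerC (w₀.1.adicCompletion (CyclotomicField (cycLevel 3 0 r) ℚ)))) :=
    ⟨not_isUnit_natCast_integerC (LocalField.valuation_adicCompletion_natCast_lt_one w₀.1 3 (three_mem_asIdeal_extension _ w₀))⟩
  haveI := isAdicComplete_integerC_natCast (LocalField.valuation_adicCompletion_natCast_lt_one w₀.1 3 (three_mem_asIdeal_extension _ w₀))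
  -- the DEFINED `exp*` at `L_{w₀}` and its lattice bound (hLatᵘ at this `(r, w₀, d_w₀)`)
  let φ₀ := expStarOmegaHom (LocalField.valuation_adicCompletion_natCast_lt_one w₀.1 3 (three_mem_asIdeal_extension _ w₀))
    ((galRestrictPlace ((Rat.HeightOneSpectrum.primesEquiv (R := 𝓞 ℚ)).symm ⟨3, Fact.out⟩)).comp
      (absGaloisRestrict (((Rat.HeightOneSpectrum.primesEquiv (R := 𝓞 ℚ)).symm ⟨3, Fact.out⟩).adicCompletion ℚ) (w₀.1.adicCompletion (CyclotomicField (cycLevel 3 0 r) ℚ)))) dw hinjw hexw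
  have htdw : ∀ z, ∀ o ∈ w₀.1.adicCompletionIntegers (CyclotomicField (cycLevel 3 0 r) ℚ),
      Algebra.trace (((Rat.HeightOneSpectrum.primesEquiv (R := 𝓞 ℚ)).symm ⟨3, Fact.out⟩).adicCompletion ℚ)
          (w₀.1.adicCompletion (CyclotomicField (cycLevel 3 0 r) ℚ))
          (((3 : ℕ) : w₀.1.adicCompletion (CyclotomicField (cycLevel 3 0 r) ℚ)) * φ₀ z * o) ∈
        (((Rat.HeightOneSpectrum.primesEquiv (R := 𝓞 ℚ)).symm ⟨3, Fact.out⟩).adicCompletionIntegers ℚ) :=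
    forall_trace_prime_mul_expStarOmegaHom_mul_mem_of_facts 3 (by norm_num) hT₂ W d hinj hex hdual r w₀ dw hinjw hexw hresw
  -- (RES₀) after the `e₃` round trip: `exp*_{d_w₀} (res h) = algebraMap (e₃ (φ h))`
  have hres₀ : ∀ h : (tateLocalRep W 3 (Sum.inr ((Rat.HeightOneSpectrum.primesEquiv (R := 𝓞 ℚ)).symm ⟨3, Fact.out⟩))).cohomology 1,
      φ₀ (ContinuousRep.cohomologyRes (tateLocalRep W 3 (Sum.inr ((Rat.HeightOneSpectrum.primesEquiv (R := 𝓞 ℚ)).symm ⟨3, Fact.out⟩)))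
        (absGaloisRestrict (((Rat.HeightOneSpectrum.primesEquiv (R := 𝓞 ℚ)).symm ⟨3, Fact.out⟩).adicCompletion ℚ) (w₀.1.adicCompletion (CyclotomicField (cycLevel 3 0 r) ℚ))) 1 h) =
      algebraMap (((Rat.HeightOneSpectrum.primesEquiv (R := 𝓞 ℚ)).symm ⟨3, Fact.out⟩).adicCompletion ℚ) (w₀.1.adicCompletion (CyclotomicField (cycLevel 3 0 r) ℚ))
        (Padic.adicCompletionEquiv (𝓞 ℚ) ⟨3, Fact.out⟩ (φ h)) := by
    intro h
    refine (hresw h).trans ?_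
    rw [expStarOmegaPadicAt_apply]
    exact congrArg _ ((Padic.adicCompletionEquiv (𝓞 ℚ) ⟨3, Fact.out⟩).apply_symm_apply _).symm
  -- `Place.Completion (Sum.inr v₀)` is `v₀.adicCompletion ℚ` by `rfl`: read the packet's algebra structure on it
  letI instEF : Algebra (NumberField.Place.Completion (K := ℚ) (Sum.inr ((Rat.HeightOneSpectrum.primesEquiv (R := 𝓞 ℚ)).symm ⟨3, Fact.out⟩)))
      (w₀.1.adicCompletion (CyclotomicField (cycLevel 3 0 r) ℚ)) :=
    inferInstanceAs (Algebra (((Rat.HeightOneSpectrum.primesEquiv (R := 𝓞 ℚ)).symm ⟨3, Fact.out⟩).adicCompletion ℚ) (w₀.1.adicCompletion (CyclotomicField (cycLevel 3 0 r) ℚ)))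
  -- PER FACTOR `w`: twisted COMPAT at `w₀` (w2-acc5), transported along `S_w = (g̃_w⁻¹)_*`, then the lattice bound
  have hfac : ∀ w : (((Rat.HeightOneSpectrum.primesEquiv (R := 𝓞 ℚ)).symm ⟨3, Fact.out⟩).Extension
      (𝓞 (CyclotomicField (cycLevel 3 0 r) ℚ))),
      ∃ μ : w.1.adicCompletion (CyclotomicField (cycLevel 3 0 r) ℚ),
        (∀ o ∈ w.1.adicCompletionIntegers (CyclotomicField (cycLevel 3 0 r) ℚ),
          Algebra.trace (((Rat.HeightOneSpectrum.primesEquiv (R := 𝓞 ℚ)).symm ⟨3, Fact.out⟩).adicCompletion ℚ)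
              (w.1.adicCompletion (CyclotomicField (cycLevel 3 0 r) ℚ))
              (((3 : ℕ) : w.1.adicCompletion (CyclotomicField (cycLevel 3 0 r) ℚ)) * μ * o) ∈
            (((Rat.HeightOneSpectrum.primesEquiv (R := 𝓞 ℚ)).symm ⟨3, Fact.out⟩).adicCompletionIntegers ℚ)) ∧
          Ψ ((φ h ⊗ₜ[ℚ] (1 : CyclotomicField (cycLevel 3 0 r) ℚ)) - Λ 0 r y) w =
            ((3 : ℕ) : w.1.adicCompletion (CyclotomicField (cycLevel 3 0 r) ℚ)) ^ (j + 1) * μ := by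
    intro w
    let S : w₀.1.adicCompletion (CyclotomicField (cycLevel 3 0 r) ℚ) →+*
        w.1.adicCompletion (CyclotomicField (cycLevel 3 0 r) ℚ) :=
      galAdicCompletionMap (sigma (cycLevel 3 0 r) (modNCyclotomicCharacter ℚ (cycLevel 3 0 r) (g w)))⁻¹
        (inv_smul_eq_of_smul_eq (hg w))
    have hS : ∀ x, S x = galAdicCompletionMap
        (sigma (cycLevel 3 0 r) (modNCyclotomicCharacter ℚ (cycLevel 3 0 r) (g w)))⁻¹
        (inv_smul_eq_of_smul_eq (hg w)) x := fun _ => rfl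
    -- the `w`-component of `Λ_{0,r}` READ BACK IN `L_{w₀}`, and `e₃ ∘ φ` in `L_{w₀}`
    let LF : H1 (tateRep W 3) (cycSubgroup 3 0 r) →+ w₀.1.adicCompletion (CyclotomicField (cycLevel 3 0 r) ℚ) :=
      (galAdicCompletionMap (sigma (cycLevel 3 0 r) (modNCyclotomicCharacter ℚ (cycLevel 3 0 r) (g w))) (hg w)).toAddMonoidHom.comp
        ((Pi.evalAddMonoidHom (fun w : (((Rat.HeightOneSpectrum.primesEquiv (R := 𝓞 ℚ)).symm ⟨3, Fact.out⟩).Extension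
          (𝓞 (CyclotomicField (cycLevel 3 0 r) ℚ))) => w.1.adicCompletion (CyclotomicField (cycLevel 3 0 r) ℚ)) w).comp
        (Ψ.toAddEquiv.toAddMonoidHom.comp (Λ 0 r).toAddMonoidHom))
    let e : (tateLocalRep W 3 (Sum.inr ((Rat.HeightOneSpectrum.primesEquiv (R := 𝓞 ℚ)).symm ⟨3, Fact.out⟩))).cohomology 1 →+ w₀.1.adicCompletion (CyclotomicField (cycLevel 3 0 r) ℚ) :=
      ((algebraMap (((Rat.HeightOneSpectrum.primesEquiv (R := 𝓞 ℚ)).symm ⟨3, Fact.out⟩).adicCompletion ℚ) (w₀.1.adicCompletion (CyclotomicField (cycLevel 3 0 r) ℚ))).toAddMonoidHom.comp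
        ((Padic.adicCompletionEquiv (𝓞 ℚ) ⟨3, Fact.out⟩).toRingEquiv.toAddMonoidHom)).comp φ
    have hLF : ∀ y, LF y = galAdicCompletionMap
        (sigma (cycLevel 3 0 r) (modNCyclotomicCharacter ℚ (cycLevel 3 0 r) (g w))) (hg w) (Ψ (Λ 0 r y) w) :=
      fun y => rfl
    have he : ∀ h, e h = algebraMap (((Rat.HeightOneSpectrum.primesEquiv (R := 𝓞 ℚ)).symm ⟨3, Fact.out⟩).adicCompletion ℚ) (w₀.1.adicCompletion (CyclotomicField (cycLevel 3 0 r) ℚ))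
        (Padic.adicCompletionEquiv (𝓞 ℚ) ⟨3, Fact.out⟩ (φ h)) := fun h => rfl
    obtain ⟨y', hy'⟩ := exists_sub_eq_zsmul_apply_of_factorDef_conjMap W 3 j 0 r ((Rat.HeightOneSpectrum.primesEquiv (R := 𝓞 ℚ)).symm ⟨3, Fact.out⟩)
      (w₀.1.adicCompletion (CyclotomicField (cycLevel 3 0 r) ℚ)) (g w)
      (absGaloisRestrictTower_adicCompletion_mem_cycSubgroup r w₀) φ₀ LF e
      (fun y φ'' hφ'' ψT hψT => by
        rw [hLF, hdefw w y φ'' ψT hφ'' hψT, galAdicCompletionMap_apply_inv]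
        rfl)
      (fun h => by rw [he]; exact hres₀ h) Ψ' hΨ' y κ₀ h hres hlocκ
    refine ⟨S (φ₀ y'), ?_, ?_⟩
    · -- the trace-dual bound at `w₀`, transported along `S_w`: traces and integers are Galois-invariant
      intro o ho
      have hTo : galAdicCompletionMap (sigma (cycLevel 3 0 r) (modNCyclotomicCharacter ℚ (cycLevel 3 0 r) (g w)))
          (hg w) o ∈ w₀.1.adicCompletionIntegers (CyclotomicField (cycLevel 3 0 r) ℚ) :=
        (galAdicCompletionMap_mem_adicCompletionIntegers_iff _ _ _ o).mpr ho
      have hSo : S (galAdicCompletionMap (sigma (cycLevel 3 0 r) (modNCyclotomicCharacter ℚ (cycLevel 3 0 r) (g w)))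
          (hg w) o) = o := by
        rw [hS, galAdicCompletionMap_inv_apply]
      have h1 : S (((3 : ℕ) : w₀.1.adicCompletion (CyclotomicField (cycLevel 3 0 r) ℚ)) * φ₀ y' *
          galAdicCompletionMap (sigma (cycLevel 3 0 r) (modNCyclotomicCharacter ℚ (cycLevel 3 0 r) (g w))) (hg w) o) =
          ((3 : ℕ) : w.1.adicCompletion (CyclotomicField (cycLevel 3 0 r) ℚ)) * S (φ₀ y') * o := by
        rw [map_mul, map_mul, map_natCast, hSo]
      rw [← h1, hS, trace_galAdicCompletionMap]
      exact htdw y' _ hTo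
    · -- transport `e h − LF y = 3^{j+1} • φ₀ y'` along `S_w`
      have hT := congrArg S hy'
      rw [map_sub, map_zsmul, hLF, hS, hS, galAdicCompletionMap_inv_apply, he,
        galAdicCompletionMap_algebraMap_adicCompletion] at hT
      rw [map_sub, Pi.sub_apply, hΨ, map_one, one_mul, hT, zsmul_eq_mul, Int.cast_pow, Int.cast_natCast]
      rfl
  choose μ hμtr hμeq using hfac
  -- the semi-local vector `t_w := 3 μ_w` (in the trace dual of `𝒪_w`) and its preimage under `Ψ`
  let t : Π w : (((Rat.HeightOneSpectrum.primesEquiv (R := 𝓞 ℚ)).symm ⟨3, Fact.out⟩).Extension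
      (𝓞 (CyclotomicField (cycLevel 3 0 r) ℚ))), w.1.adicCompletion (CyclotomicField (cycLevel 3 0 r) ℚ) :=
    fun w => ((3 : ℕ) : w.1.adicCompletion (CyclotomicField (cycLevel 3 0 r) ℚ)) ^ (1 : ℕ) * μ w
  have ht : ∀ w, t w = ((3 : ℕ) : w.1.adicCompletion (CyclotomicField (cycLevel 3 0 r) ℚ)) ^ (1 : ℕ) * μ w := fun _ => rfl
  -- `Ψ (3 • X) = 3^{j+1} • t`
  have hX : Ψ (((3 ^ (1 : ℕ) : ℕ) : ℤ_[3]) • ((φ h ⊗ₜ[ℚ] (1 : CyclotomicField (cycLevel 3 0 r) ℚ)) - Λ 0 r y)) =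
      (3 ^ (j + 1) : ℕ) • t := by
    rw [Nat.cast_smul_eq_nsmul, map_nsmul]
    funext w
    rw [Pi.smul_apply, Pi.smul_apply, hμeq, ht, nsmul_eq_mul, nsmul_eq_mul, Nat.cast_pow, Nat.cast_pow]
    ring
  have hX' : (((3 : ℕ) : ℤ_[3]) ^ (1 : ℕ)) • ((φ h ⊗ₜ[ℚ] (1 : CyclotomicField (cycLevel 3 0 r) ℚ)) - Λ 0 r y) =
      (((3 : ℕ) : ℤ_[3]) ^ (j + 1)) • Ψ.symm t := by
    rw [← Nat.cast_pow, ← Ψ.symm_apply_apply ((((3 ^ (1 : ℕ) : ℕ) : ℤ_[3])) • _), hX, ← Nat.cast_pow,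
      Nat.cast_smul_eq_nsmul, map_nsmul]
  -- `(1 ⊗ θ_r)·Ψ⁻¹ t ∈ L_int`: tame by w2-acc3's self-duality, wild by the sharp different
  haveI := HeightOneSpectrum.Extension.fintype (𝓞 ℚ) ℚ (CyclotomicField (cycLevel 3 0 r) ℚ)
    (𝓞 (CyclotomicField (cycLevel 3 0 r) ℚ)) ((Rat.HeightOneSpectrum.primesEquiv (R := 𝓞 ℚ)).symm ⟨3, Fact.out⟩)
  have htr' : ∀ w, ∀ o ∈ w.1.adicCompletionIntegers (CyclotomicField (cycLevel 3 0 r) ℚ),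
      Algebra.trace (((Rat.HeightOneSpectrum.primesEquiv (R := 𝓞 ℚ)).symm ⟨3, Fact.out⟩).adicCompletion ℚ)
          (w.1.adicCompletion (CyclotomicField (cycLevel 3 0 r) ℚ)) (t w * o) ∈
        (((Rat.HeightOneSpectrum.primesEquiv (R := 𝓞 ℚ)).symm ⟨3, Fact.out⟩).adicCompletionIntegers ℚ) := by
    intro w o ho; rw [ht, pow_one]; exact hμtr w o ho
  have hl : ((1 : ℚ_[3]) ⊗ₜ[ℚ] θ r) * Ψ.symm t ∈ cycIntLattice 3 (cycLevel 3 0 r) := by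
    by_cases h3 : 3 ∣ cycLevel 3 0 r
    · rw [hθdef, if_pos h3]
      exact wild_mul_symm_mem_cycIntLattice_of_forall_trace_mul_mem 3 (Nat.mul_div_cancel' h3).symm Ψ hΨ t htr'
    · rw [hθdef, if_neg h3, ← Algebra.TensorProduct.one_def, one_mul]
      exact symm_mem_cycIntLattice_of_forall_trace_mul_mem (cycLevel 3 0 r) 3 h3 Ψ hΨ t htr'
  refine ⟨((1 : ℚ_[3]) ⊗ₜ[ℚ] θ r) * Ψ.symm t, hl, ?_⟩
  rw [hX', mul_smul_comm]

end Summit.BirchSwinnertonDyer.BirchSwinnertonDyer.Theorems.KimAtThreeShallowEqDeepWeightedOfKatoV2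

end
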